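import Summits.CriticalPhenomena.PercolationContinuityZ3.Theorems.Transplant.Slab111HubXTree
import HarnessLib

/-!
# The HUB ROUTING of the `(111)`-films, XXXI-Xb: FAST box tests (closed-form interval atoms) and the tree checker `treeOK2`

builds on p205010 (kernel theorem, internal audit signed; external expert review pending) — NOT used in this file.  Lane `prim-bschramm`, seat
`prim-bschramm-p2` (gen 37; class C1b; memo `HOME/bschramm/P2-LATTICES.md` §135); helper file (`--supports stmt-CriticalPhenomena-4575 --as helper`).
Kernel-speed versions of the box tests of «Slab111HubXLang» / «Slab111HubXTree»: §1 an atom holds (fails) on a whole interval by a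
CLOSED-FORM test on the interval ends (`Atom.trueOnI`, `Atom.falseOnI`, soundness by case analysis on the kind); §2 the formula tests with the
exact rule for clauses (a clause holds on a box iff on SOME coordinate its atoms jointly cover the interval — `trueOnC2`); §2b a PROPAGATING
emptiness test `emptyP` (interval constraint propagation over `d_ij = n_j − n_i = t_i − t_j`, `k = n_i + t_i ≥ kmin`); §3 **`treeOK2`**: the
tree checker with these tests and the well-sortedness of the entry formulas checked ONCE (hypothesis `hws`), with soundness **`treeOK2_sound`**.
[cite: DuminilCopinSidoraviciusTassion2016, §2.3 (proof of Fact 2: the three disjoint paths γ_u, γ_v, γ_w in B_R(z))]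
-/

namespace Summit.CriticalPhenomena.PercolationContinuityZ3.Theorems.Transplant

namespace Slab111

/-! ## §1 Closed-form interval atoms -/

/-- **An atom holds at every value of `[lo, hi]`** (closed form; vacuously true intervals are not exploited). [folklore] -/
def Atom.trueOnI (a : Atom) (lo hi : ℤ) : Bool :=
  match a.kd with
  | .dgt => decide (a.x < XM ∧ a.x + 1 ≤ lo ∧ -XM + 1 ≤ lo ∧ hi ≤ XM)
  | .dlt => decide (-XM < a.x ∧ hi ≤ a.x - 1 ∧ hi ≤ XM - 1 ∧ -XM ≤ lo)
  | .bge => decide (-a.x ≤ lo)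
  | .bne0 => decide (hi ≤ XB ∧ ¬ (lo ≤ -a.x ∧ -a.x ≤ min hi (XB - 1)) ∧ (XB ≤ hi → 0 < XB + a.x))
  | .beq0 => decide (lo = hi ∧ lo + a.x = 0 ∧ lo < XB)
  | .tle => decide (a.x ≤ lo)
  | .tnek => decide (hi ≤ XB ∧ ¬ (lo ≤ a.x ∧ a.x ≤ min hi (XB - 1)) ∧ (XB ≤ hi → a.x < XB))
  | .teqk => decide (lo = hi ∧ lo = a.x ∧ lo < XB)

/-- **An atom fails at every value of `[lo, hi]`** (closed form). [folklore] -/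
def Atom.falseOnI (a : Atom) (lo hi : ℤ) : Bool :=
  match a.kd with
  | .dgt => decide (XM ≤ a.x ∨ hi ≤ a.x ∨ hi ≤ -XM ∨ (XM < lo))
  | .dlt => decide (a.x ≤ -XM ∨ a.x ≤ lo ∧ (lo ≠ -XM ∨ a.x ≤ -XM) ∨ XM ≤ lo ∧ lo ≠ -XM ∨ hi < -XM)
  | .bge => decide (hi < -a.x)
  | .bne0 => decide ((lo = hi ∧ lo + a.x = 0 ∧ lo < XB) ∨ (lo = hi ∧ lo = XB ∧ ¬ 0 < XB + a.x) ∨ XB < lo)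
  | .beq0 => decide (-a.x < lo ∨ hi < -a.x ∨ XB ≤ -a.x)
  | .tle => decide (hi < a.x)
  | .tnek => decide ((lo = hi ∧ lo = a.x ∧ lo < XB) ∨ (lo = hi ∧ lo = XB ∧ ¬ a.x < XB) ∨ XB < lo)
  | .teqk => decide (a.x < lo ∨ hi < a.x ∨ XB ≤ a.x)

/-- Soundness of `Atom.trueOnI`. [folklore] -/
theorem Atom.trueOnI_sound (a : Atom) {lo hi v : ℤ} (h : a.trueOnI lo hi = true) (h1 : lo ≤ v) (h2 : v ≤ hi) : a.evalV v = true := by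
  unfold Atom.trueOnI at h; unfold Atom.evalV
  cases hk : a.kd <;> rw [hk] at h <;> simp only [decide_eq_true_eq, XM, XB] at h ⊢ <;> omega

/-- Soundness of `Atom.falseOnI`. [folklore] -/
theorem Atom.falseOnI_sound (a : Atom) {lo hi v : ℤ} (h : a.falseOnI lo hi = true) (h1 : lo ≤ v) (h2 : v ≤ hi) : a.evalV v = false := by
  rw [Bool.eq_false_iff]
  intro hv
  unfold Atom.falseOnI at h; unfold Atom.evalV at hv
  cases hk : a.kd <;> rw [hk] at h hv <;> simp only [decide_eq_true_eq, XM, XB] at h hv <;> omega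

/-! ## §2 Fast formula tests -/

/-- An atom holds on the box (closed form). [folklore] -/
def Atom.trueOn2 (bx : Box) (a : Atom) : Bool := a.trueOnI (bx.lo.getD a.i 0) (bx.hi.getD a.i 0)
/-- An atom fails on the box (closed form). [folklore] -/
def Atom.falseOn2 (bx : Box) (a : Atom) : Bool := a.falseOnI (bx.lo.getD a.i 0) (bx.hi.getD a.i 0)

/-- **Exact clause test**: some atom holds throughout, or on some coordinate the clause's atoms jointly cover the interval (pointwise). [folklore] -/
def trueOnC2 (bx : Box) (c : List Atom) : Bool :=
  c.any (Atom.trueOn2 bx) ||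
    c.any fun a0 => allIn (bx.lo.getD a0.i 0) (bx.hi.getD a0.i 0) fun v => c.any fun a => a.i == a0.i && a.evalV v
/-- Fast: the clause fails throughout. [folklore] -/
def falseOnC2 (bx : Box) (c : List Atom) : Bool := c.all (Atom.falseOn2 bx)
/-- Fast: the cube holds throughout. [folklore] -/
def trueOnQ2 (bx : Box) (q : List (List Atom)) : Bool := q.all (trueOnC2 bx)
/-- Fast: the cube fails throughout. [folklore] -/
def falseOnQ2 (bx : Box) (q : List (List Atom)) : Bool := q.any (falseOnC2 bx)
/-- Fast: the disjunction holds throughout. [folklore] -/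
def trueOnD2 (bx : Box) (d : List (List (List Atom))) : Bool := d.any (trueOnQ2 bx)
/-- Fast: the disjunction fails throughout. [folklore] -/
def falseOnD2 (bx : Box) (d : List (List (List Atom))) : Bool := d.all (falseOnQ2 bx)
/-- **Fast: the formula holds throughout the box.** [folklore] -/
def Fm.trueOn2 (bx : Box) (f : Fm) : Bool := f.all (trueOnD2 bx)

/-- Soundness of the exact clause test. [folklore] -/
theorem trueOnC2_sound {bx : Box} {c : List Atom} (hws : c.all Atom.ws = true) (h : trueOnC2 bx c = true) {p : Pat} (hp : bx.mem p) :
    evalC p c = true := by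
  unfold trueOnC2 at h; unfold evalC
  rw [List.all_eq_true] at hws
  rw [Bool.or_eq_true, List.any_eq_true, List.any_eq_true] at h
  rw [List.any_eq_true]
  rcases h with ⟨a, ha, ht⟩ | ⟨a0, ha0, hall⟩
  · have hi := Atom.i_le_of_ws (hws a ha)
    exact ⟨a, ha, by unfold Atom.eval; exact a.trueOnI_sound ht (hp a.i hi).1 (hp a.i hi).2⟩
  · have hi := Atom.i_le_of_ws (hws a0 ha0)
    have := allIn_sound hall (hp a0.i hi).1 (hp a0.i hi).2
    rw [List.any_eq_true] at this
    obtain ⟨a, ha, hh⟩ := this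
    rw [Bool.and_eq_true, beq_iff_eq] at hh
    refine ⟨a, ha, ?_⟩
    unfold Atom.eval; rw [hh.1]; exact hh.2

/-- Soundness of `falseOnC2`. [folklore] -/
theorem falseOnC2_sound {bx : Box} {c : List Atom} (hws : c.all Atom.ws = true) (h : falseOnC2 bx c = true) {p : Pat} (hp : bx.mem p) :
    evalC p c = false := by
  unfold falseOnC2 at h; unfold evalC
  rw [List.all_eq_true] at hws h
  rw [Bool.eq_false_iff, ne_eq, List.any_eq_true, not_exists]
  intro a ⟨ha, hev⟩
  have hi := Atom.i_le_of_ws (hws a ha)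
  have := a.falseOnI_sound (h a ha) (hp a.i hi).1 (hp a.i hi).2
  unfold Atom.eval at hev; rw [this] at hev; exact Bool.false_ne_true hev

/-- Soundness of `Fm.trueOn2`. [folklore] -/
theorem Fm.trueOn2_sound {bx : Box} {f : Fm} (hws : f.ws = true) (h : f.trueOn2 bx = true) {p : Pat} (hp : bx.mem p) : f.eval p = true := by
  unfold Fm.trueOn2 at h; unfold Fm.eval; unfold Fm.ws at hws
  rw [List.all_eq_true] at h hws ⊢
  intro d hd
  have h1 := h d hd; have w1 := hws d hd
  unfold trueOnD2 at h1; unfold evalD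
  rw [List.any_eq_true] at h1 ⊢; rw [List.all_eq_true] at w1
  obtain ⟨q, hq, h2⟩ := h1
  refine ⟨q, hq, ?_⟩
  have w2 := w1 q hq
  unfold trueOnQ2 at h2; unfold evalQ
  rw [List.all_eq_true] at h2 w2 ⊢
  intro c hc
  exact trueOnC2_sound (w2 c hc) (h2 c hc) hp

/-- Soundness of `falseOnD2`. [folklore] -/
theorem falseOnD2_sound {bx : Box} {d : List (List (List Atom))} (hws : (d.all fun q => q.all fun c => c.all Atom.ws) = true)
    (h : falseOnD2 bx d = true) {p : Pat} (hp : bx.mem p) : evalD p d = false := by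
  unfold falseOnD2 at h; unfold evalD
  rw [List.all_eq_true] at h hws
  rw [Bool.eq_false_iff, ne_eq, List.any_eq_true, not_exists]
  intro q ⟨hq, hev⟩
  have h3 := h q hq; have w2 := hws q hq
  unfold falseOnQ2 at h3; unfold evalQ at hev
  rw [List.any_eq_true] at h3; rw [List.all_eq_true] at hev w2
  obtain ⟨c, hc, h4⟩ := h3
  have := falseOnC2_sound (w2 c hc) h4 hp
  rw [hev c hc] at this; exact Bool.noConfusion this

/-! ## §2b The propagating emptiness test -/

/-- The interval state of the propagation: real differences `d12 d13 d23`, levels `n1 n2 n3`, top distances `t1 t2 t3`, thickness `k`. [folklore] -/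
structure PState where
  (d12 d13 d23 n1 n2 n3 t1 t2 t3 kk : Ivl)

/-- The real quantities of a configuration lie in the state's intervals. [folklore] -/
def PState.Inv (s : PState) (n₁ n₂ n₃ k : ℤ) : Prop :=
  s.d12.mem (n₂ - n₁) ∧ s.d13.mem (n₃ - n₁) ∧ s.d23.mem (n₃ - n₂) ∧ s.n1.mem n₁ ∧ s.n2.mem n₂ ∧ s.n3.mem n₃ ∧
    s.t1.mem (k - n₁) ∧ s.t2.mem (k - n₂) ∧ s.t3.mem (k - n₃) ∧ s.kk.mem k

/-- **One propagation step** over the constraints `d_ij = n_j − n_i = t_i − t_j`, `d23 = d13 − d12`, `k = n_i + t_i`. [folklore] -/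
def PState.step (s : PState) : PState :=
  let d12 := ((s.d12.inter (s.n2.sub s.n1)).inter (s.t1.sub s.t2)).inter (s.d13.sub s.d23)
  let d13 := ((s.d13.inter (s.n3.sub s.n1)).inter (s.t1.sub s.t3)).inter (d12.add s.d23)
  let d23 := ((s.d23.inter (s.n3.sub s.n2)).inter (s.t2.sub s.t3)).inter (d13.sub d12)
  let kk := ((s.kk.inter (s.n1.add s.t1)).inter (s.n2.add s.t2)).inter (s.n3.add s.t3)
  let n1 := ((s.n1.inter (kk.sub s.t1)).inter (s.n2.sub d12)).inter (s.n3.sub d13)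
  let n2 := ((s.n2.inter (kk.sub s.t2)).inter (n1.add d12)).inter (s.n3.sub d23)
  let n3 := ((s.n3.inter (kk.sub s.t3)).inter (n1.add d13)).inter (n2.add d23)
  let t1 := s.t1.inter (kk.sub n1)
  let t2 := s.t2.inter (kk.sub n2)
  let t3 := s.t3.inter (kk.sub n3)
  ⟨d12, d13, d23, n1, n2, n3, t1, t2, t3, kk⟩

/-- Some interval of the state is empty. [folklore] -/
def PState.anyEmpty (s : PState) : Bool :=
  s.d12.isEmpty || s.d13.isEmpty || s.d23.isEmpty || s.n1.isEmpty || s.n2.isEmpty || s.n3.isEmpty || s.t1.isEmpty || s.t2.isEmpty ||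
    s.t3.isEmpty || s.kk.isEmpty

/-- The step preserves the invariant. [folklore] -/
theorem PState.step_inv {s : PState} {n₁ n₂ n₃ k : ℤ} (h : s.Inv n₁ n₂ n₃ k) : s.step.Inv n₁ n₂ n₃ k := by
  obtain ⟨e12, e13, e23, b1, b2, b3, t1, t2, t3, hk⟩ := h
  have r : ∀ {I : Ivl} {x y : ℤ}, I.mem x → x = y → I.mem y := fun h e => e ▸ h
  have d12 : s.step.d12.mem (n₂ - n₁) :=
    Ivl.mem_inter (Ivl.mem_inter (Ivl.mem_inter e12 (r (Ivl.mem_sub b2 b1) (by ring))) (r (Ivl.mem_sub t1 t2) (by ring))) (r (Ivl.mem_sub e13 e23) (by ring))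
  have d13 : s.step.d13.mem (n₃ - n₁) :=
    Ivl.mem_inter (Ivl.mem_inter (Ivl.mem_inter e13 (r (Ivl.mem_sub b3 b1) (by ring))) (r (Ivl.mem_sub t1 t3) (by ring))) (r (Ivl.mem_add d12 e23) (by ring))
  have d23 : s.step.d23.mem (n₃ - n₂) :=
    Ivl.mem_inter (Ivl.mem_inter (Ivl.mem_inter e23 (r (Ivl.mem_sub b3 b2) (by ring))) (r (Ivl.mem_sub t2 t3) (by ring))) (r (Ivl.mem_sub d13 d12) (by ring))
  have kk : s.step.kk.mem k :=
    Ivl.mem_inter (Ivl.mem_inter (Ivl.mem_inter hk (r (Ivl.mem_add b1 t1) (by ring))) (r (Ivl.mem_add b2 t2) (by ring))) (r (Ivl.mem_add b3 t3) (by ring))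
  have n1 : s.step.n1.mem n₁ :=
    Ivl.mem_inter (Ivl.mem_inter (Ivl.mem_inter b1 (r (Ivl.mem_sub kk t1) (by ring))) (r (Ivl.mem_sub b2 d12) (by ring))) (r (Ivl.mem_sub b3 d13) (by ring))
  have n2 : s.step.n2.mem n₂ :=
    Ivl.mem_inter (Ivl.mem_inter (Ivl.mem_inter b2 (r (Ivl.mem_sub kk t2) (by ring))) (r (Ivl.mem_add n1 d12) (by ring))) (r (Ivl.mem_sub b3 d23) (by ring))
  have n3 : s.step.n3.mem n₃ :=
    Ivl.mem_inter (Ivl.mem_inter (Ivl.mem_inter b3 (r (Ivl.mem_sub kk t3) (by ring))) (r (Ivl.mem_add n1 d13) (by ring))) (r (Ivl.mem_add n2 d23) (by ring))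
  exact ⟨d12, d13, d23, n1, n2, n3, Ivl.mem_inter t1 (r (Ivl.mem_sub kk n1) (by ring)), Ivl.mem_inter t2 (r (Ivl.mem_sub kk n2) (by ring)),
    Ivl.mem_inter t3 (r (Ivl.mem_sub kk n3) (by ring)), kk⟩

/-- A state with an empty interval has no configuration. [folklore] -/
theorem PState.not_inv_of_anyEmpty {s : PState} (h : s.anyEmpty = true) {n₁ n₂ n₃ k : ℤ} : ¬ s.Inv n₁ n₂ n₃ k := by
  intro hi
  obtain ⟨e12, e13, e23, b1, b2, b3, t1, t2, t3, hk⟩ := hi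
  unfold PState.anyEmpty at h
  simp only [Bool.or_eq_true] at h
  rcases h with ((((((((h | h) | h) | h) | h) | h) | h) | h) | h) | h
  · exact Ivl.not_mem_of_isEmpty h _ e12
  · exact Ivl.not_mem_of_isEmpty h _ e13
  · exact Ivl.not_mem_of_isEmpty h _ e23
  · exact Ivl.not_mem_of_isEmpty h _ b1
  · exact Ivl.not_mem_of_isEmpty h _ b2
  · exact Ivl.not_mem_of_isEmpty h _ b3
  · exact Ivl.not_mem_of_isEmpty h _ t1
  · exact Ivl.not_mem_of_isEmpty h _ t2
  · exact Ivl.not_mem_of_isEmpty h _ t3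
  · exact Ivl.not_mem_of_isEmpty h _ hk

/-- The initial state of a box (unclamped coordinates, `k ≥ kmin`). [folklore] -/
def PState.ofBox (kmin : ℤ) (bx : Box) : PState :=
  let g := fun i => (bx.lo.getD i 0, bx.hi.getD i 0)
  ⟨unclampD (g 0).1 (g 0).2, unclampD (g 1).1 (g 1).2, unclampD (g 2).1 (g 2).2, unclampB (g 3).1 (g 3).2, unclampB (g 5).1 (g 5).2,
    unclampB (g 7).1 (g 7).2, unclampB (g 4).1 (g 4).2, unclampB (g 6).1 (g 6).2, unclampB (g 8).1 (g 8).2, ⟨some kmin, none⟩⟩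

/-- The initial state holds every configuration of the box with `k ≥ kmin`. [folklore] -/
theorem PState.ofBox_inv {kmin : ℤ} {bx : Box} {n₁ n₂ n₃ k : ℤ} (h1 : 0 ≤ n₁ ∧ n₁ ≤ k) (h2 : 0 ≤ n₂ ∧ n₂ ≤ k) (h3 : 0 ≤ n₃ ∧ n₃ ≤ k)
    (hk : kmin ≤ k) (hm : bx.mem (patOf n₁ n₂ n₃ k)) : (PState.ofBox kmin bx).Inv n₁ n₂ n₃ k := by
  have g : ∀ i, i ≤ 8 → bx.lo.getD i 0 ≤ (patOf n₁ n₂ n₃ k).get i ∧ (patOf n₁ n₂ n₃ k).get i ≤ bx.hi.getD i 0 := hm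
  have m0 := g 0 (by norm_num); have m1 := g 1 (by norm_num); have m2 := g 2 (by norm_num); have m3 := g 3 (by norm_num)
  have m4 := g 4 (by norm_num); have m5 := g 5 (by norm_num); have m6 := g 6 (by norm_num); have m7 := g 7 (by norm_num)
  have m8 := g 8 (by norm_num)
  simp only [patOf, Pat.get] at m0 m1 m2 m3 m4 m5 m6 m7 m8
  exact ⟨mem_unclampD m0.1 m0.2, mem_unclampD m1.1 m1.2, mem_unclampD m2.1 m2.2, mem_unclampB h1.1 m3.1 m3.2, mem_unclampB h2.1 m5.1 m5.2,
    mem_unclampB h3.1 m7.1 m7.2, mem_unclampB (n := k - n₁) (by omega) m4.1 m4.2, mem_unclampB (n := k - n₂) (by omega) m6.1 m6.2,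
    mem_unclampB (n := k - n₃) (by omega) m8.1 m8.2,
    ⟨fun l hl => by change some kmin = some l at hl; simp only [Option.some.injEq] at hl; omega, fun h hh => by change (none : Option ℤ) = some h at hh; simp at hh⟩⟩

/-- **The propagating emptiness test**: three propagation rounds (emptiness after any of them) or the class test. [folklore] -/
def emptyP (kmin lam12 lam13 : ℤ) (bx : Box) : Bool :=
  let s0 := PState.ofBox kmin bx
  let s1 := s0.step
  let s2 := s1.step
  let s3 := s2.step
  s1.anyEmpty || s2.anyEmpty || s3.anyEmpty ||
    classBad (bx.lo.getD 0 0) (bx.hi.getD 0 0) lam12 || classBad (bx.lo.getD 1 0) (bx.hi.getD 1 0) lam13 ||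
    classBad (bx.lo.getD 2 0) (bx.hi.getD 2 0) (lam13 - lam12)

/-- **Soundness of the propagating emptiness test.** [folklore] -/
theorem emptyP_sound {kmin lam12 lam13 : ℤ} {bx : Box} (h : emptyP kmin lam12 lam13 bx = true) {n₁ n₂ n₃ k : ℤ}
    (h1 : 0 ≤ n₁ ∧ n₁ ≤ k) (h2 : 0 ≤ n₂ ∧ n₂ ≤ k) (h3 : 0 ≤ n₃ ∧ n₃ ≤ k) (hk : kmin ≤ k) (hc12 : (3 : ℤ) ∣ (n₂ - n₁) - lam12)
    (hc13 : (3 : ℤ) ∣ (n₃ - n₁) - lam13) : ¬ bx.mem (patOf n₁ n₂ n₃ k) := by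
  intro hm
  have i0 := PState.ofBox_inv h1 h2 h3 hk hm (kmin := kmin)
  have i1 := PState.step_inv i0
  have i2 := PState.step_inv i1
  have i3 := PState.step_inv i2
  have g : ∀ i, i ≤ 8 → bx.lo.getD i 0 ≤ (patOf n₁ n₂ n₃ k).get i ∧ (patOf n₁ n₂ n₃ k).get i ≤ bx.hi.getD i 0 := hm
  have m0 := g 0 (by norm_num); have m1 := g 1 (by norm_num); have m2 := g 2 (by norm_num)
  simp only [patOf, Pat.get] at m0 m1 m2
  unfold emptyP at h
  simp only [Bool.or_eq_true] at h
  rcases h with ((((h | h) | h) | h) | h) | h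
  · exact PState.not_inv_of_anyEmpty h i1
  · exact PState.not_inv_of_anyEmpty h i2
  · exact PState.not_inv_of_anyEmpty h i3
  all_goals
    unfold classBad at h
    simp only [Bool.and_eq_true, decide_eq_true_eq] at h
    obtain ⟨⟨hlo, hhi⟩, hall⟩ := h
  · have hv := allIn_sound hall m0.1 m0.2
    simp only [decide_eq_true_eq] at hv
    apply hv; unfold XM at hlo hhi; unfold clampZ XM at m0 ⊢
    rwa [show max (-13) (min 13 (n₂ - n₁)) = n₂ - n₁ by omega]
  · have hv := allIn_sound hall m1.1 m1.2
    simp only [decide_eq_true_eq] at hv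
    apply hv; unfold XM at hlo hhi; unfold clampZ XM at m1 ⊢
    rwa [show max (-13) (min 13 (n₃ - n₁)) = n₃ - n₁ by omega]
  · have hv := allIn_sound hall m2.1 m2.2
    simp only [decide_eq_true_eq] at hv
    apply hv; unfold XM at hlo hhi; unfold clampZ XM at m2 ⊢
    rw [show max (-13) (min 13 (n₃ - n₂)) = n₃ - n₂ by omega]
    have := dvd_sub hc13 hc12
    rwa [show n₃ - n₁ - lam13 - (n₂ - n₁ - lam12) = n₃ - n₂ - (lam13 - lam12) by ring] at this

/-! ## §3 The fast tree checker -/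

/-- **The fast tree checker** (entry formulas' well-sortedness is a hypothesis of the soundness theorem, checked once by the caller). [folklore] -/
def treeOK2 (ents : List (Bool × Fm)) (rules : Fm) (kmin lam12 lam13 : ℤ) : ℕ → Box → Tree → Bool
  | 0, _, _ => false
  | _ + 1, bx, .ent i => match ents[i]? with
    | some (st, f) => st && f.trueOn2 bx
    | none => false
  | _ + 1, bx, .excl j => match rules[j]? with
    | some D => (D.all fun q => q.all fun c => c.all Atom.ws) && falseOnD2 bx D
    | none => false
  | _ + 1, bx, .emp => emptyP kmin lam12 lam13 bx
  | fuel + 1, bx, .node c kids =>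
    decide (c ≤ 8) && coverB bx c kids && kids.all fun kd => treeOK2 ents rules kmin lam12 lam13 fuel (bx.restrict c kd.1 kd.2.1) kd.2.2

/-- **SOUNDNESS OF THE FAST TREE CHECKER.** [folklore] -/
theorem treeOK2_sound {ents : List (Bool × Fm)} {rules : Fm} {kmin lam12 lam13 : ℤ} {n₁ n₂ n₃ k : ℤ}
    (hws : ∀ sf ∈ ents, sf.2.ws = true)
    (h1 : 0 ≤ n₁ ∧ n₁ ≤ k) (h2 : 0 ≤ n₂ ∧ n₂ ≤ k) (h3 : 0 ≤ n₃ ∧ n₃ ≤ k) (hk : kmin ≤ k) (hc12 : (3 : ℤ) ∣ (n₂ - n₁) - lam12)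
    (hc13 : (3 : ℤ) ∣ (n₃ - n₁) - lam13) (hrules : rules.eval (patOf n₁ n₂ n₃ k) = true) :
    ∀ (fuel : ℕ) (bx : Box) (t : Tree), bx.lo.length = 9 ∧ bx.hi.length = 9 → treeOK2 ents rules kmin lam12 lam13 fuel bx t = true →
      bx.mem (patOf n₁ n₂ n₃ k) → ∃ sf ∈ ents, sf.1 = true ∧ sf.2.eval (patOf n₁ n₂ n₃ k) = true := by
  intro fuel
  induction fuel with
  | zero => intro bx t _ h; simp [treeOK2] at h
  | succ fuel ih =>
    intro bx t hlen h hm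
    cases t with
    | ent i =>
      unfold treeOK2 at h
      cases hg : ents[i]? with
      | none => rw [hg] at h; exact Bool.noConfusion h
      | some sf =>
        rw [hg] at h
        obtain ⟨st, f⟩ := sf
        simp only [Bool.and_eq_true] at h
        have hmem : (st, f) ∈ ents := List.mem_of_getElem? hg
        exact ⟨(st, f), hmem, h.1, Fm.trueOn2_sound (hws _ hmem) h.2 hm⟩
    | excl j =>
      unfold treeOK2 at h
      cases hg : rules[j]? with
      | none => rw [hg] at h; exact Bool.noConfusion h
      | some D =>
        rw [hg] at h
        simp only [Bool.and_eq_true] at h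
        have hf := falseOnD2_sound h.1 h.2 hm
        have hD : D ∈ rules := List.mem_of_getElem? hg
        unfold Fm.eval at hrules
        rw [List.all_eq_true] at hrules
        rw [hrules D hD] at hf; exact absurd hf (by decide)
    | emp =>
      unfold treeOK2 at h
      exact absurd hm (emptyP_sound h h1 h2 h3 hk hc12 hc13)
    | node c kids =>
      unfold treeOK2 at h
      simp only [Bool.and_eq_true, decide_eq_true_eq] at h
      obtain ⟨⟨hc, hcov⟩, hall⟩ := h
      have hv := hm c hc
      have hcov' := allIn_sound hcov hv.1 hv.2
      rw [List.any_eq_true] at hcov'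
      obtain ⟨kd, hkd, hin⟩ := hcov'
      rw [decide_eq_true_eq] at hin
      rw [List.all_eq_true] at hall
      exact ih _ _ (Box.restrict_len hlen _ _ _) (hall kd hkd) (Box.mem_restrict hm hlen hin.1 hin.2)

end Slab111

end Summit.CriticalPhenomena.PercolationContinuityZ3.Theorems.Transplant
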